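import Summits.Parity.BatemanHorn.Theorems.SoloInformedPowerValuesAll

/-!
# `k`-th power values of an irreducible integer polynomial: a power saving

SOLOIST deliverable (unit `solo-Parity-informed`, session 16).  `SoloInformedPowerValuesAll` exported the
count of `n ≤ x` with `|g(n)|` a perfect `k`-th power (`g ∈ ℤ[X]` irreducible, `deg g ≥ 1`, positive leading
coefficient, `k ≥ 2`) only in the form `# · log x ≤ δ x`.  The same divided-difference argument gives a
power saving, which is what the `k`-tuple (Bateman–Horn system) bookkeeping needs against `log^k` weights:

* `exists_eventually_card_powValues_le_rpow` : `#{n ≤ x : |g(n)| = m^k} ≤ C x^{1-η}` eventually, for some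
  `η > 0` and `C`;
* `eventually_mul_log_pow_le_of_le_rpow` : any `u(x) ≤ C x^{1-η}` has `u(x) log^j x ≤ δ x` eventually;
* `eventually_card_powValues_mul_log_pow_le` : hence `#{n ≤ x : |g(n)| = m^k} · log^j x ≤ δ x` eventually,
  every `j` and `δ > 0`.
-/

namespace Summit.Parity.BatemanHorn.Theorems

open Finset Filter Polynomial Asymptotics
open scoped Topology

/-- `log^j x ≤ c x^r` eventually along the naturals (`r, c > 0`). -/
theorem eventually_log_pow_le_mul_rpow (j : ℕ) {r c : ℝ} (hr : 0 < r) (hc : 0 < c) :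
    ∀ᶠ x : ℕ in atTop, Real.log x ^ j ≤ c * (x : ℝ) ^ r := by
  have h := ((isLittleO_log_rpow_rpow_atTop (j : ℝ) hr).comp_tendsto tendsto_natCast_atTop_atTop).def hc
  filter_upwards [h, eventually_ge_atTop 1] with x hx hx1
  simp only [Function.comp_apply, Real.norm_eq_abs] at hx
  rw [abs_of_nonneg (Real.rpow_nonneg (Nat.cast_nonneg x) r), Real.rpow_natCast] at hx
  exact (le_abs_self _).trans hx

/-- **From a power saving to every power of `log`:** if `u(x) ≤ C x^{1-η}` eventually (`η > 0`) then
`u(x) · log^j x ≤ δ x` eventually, for every `j` and `δ > 0`. -/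
theorem eventually_mul_log_pow_le_of_le_rpow {u : ℕ → ℝ} {η C : ℝ} (hη : 0 < η)
    (hu : ∀ᶠ x : ℕ in atTop, u x ≤ C * (x : ℝ) ^ (1 - η)) (j : ℕ) {δ : ℝ} (hδ : 0 < δ) :
    ∀ᶠ x : ℕ in atTop, u x * Real.log x ^ j ≤ δ * x := by
  set C' : ℝ := max C 1 with hC'
  have hC'0 : 0 < C' := lt_of_lt_of_le one_pos (le_max_right _ _)
  filter_upwards [hu, eventually_log_pow_le_mul_rpow j hη (show 0 < δ / C' by positivity),
    eventually_ge_atTop 1] with x hux hlx hx1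
  have hxpos : (0 : ℝ) < x := by exact_mod_cast (show 0 < x by omega)
  have hx0 : (0 : ℝ) ≤ (x : ℝ) ^ (1 - η) := Real.rpow_nonneg hxpos.le _
  have hux' : u x ≤ C' * (x : ℝ) ^ (1 - η) :=
    hux.trans (mul_le_mul_of_nonneg_right (le_max_left _ _) hx0)
  have hlog0 : 0 ≤ Real.log x ^ j := pow_nonneg (Real.log_nonneg (by exact_mod_cast hx1)) j
  calc u x * Real.log x ^ j ≤ (C' * (x : ℝ) ^ (1 - η)) * (δ / C' * (x : ℝ) ^ η) :=
        mul_le_mul hux' hlx hlog0 (by positivity)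
    _ = δ * ((x : ℝ) ^ (1 - η) * (x : ℝ) ^ η) := by field_simp
    _ = δ * x := by
        rw [← Real.rpow_add hxpos, sub_add_cancel, Real.rpow_one]

open scoped Classical in
/-- **Power saving for `k`-th power values.**  For `g ∈ ℤ[X]` irreducible of degree `≥ 1` with positive
leading coefficient and `k ≥ 2` there are `η > 0` and `C` with `#{n ≤ x : |g(n)| = m^k for some m} ≤ C x^{1-η}`
eventually. -/
theorem exists_eventually_card_powValues_le_rpow {g : ℤ[X]} (hirr : Irreducible g)
    (hdeg : 1 ≤ g.natDegree) (hlc : 0 < g.leadingCoeff) {k : ℕ} (hk : 2 ≤ k) :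
    ∃ η C : ℝ, 0 < η ∧ ∀ᶠ x : ℕ in atTop,
      (#((Icc 1 x).filter fun n : ℕ => ∃ m : ℕ, (g.eval (n : ℤ)).natAbs = m ^ k) : ℝ)
        ≤ C * (x : ℝ) ^ (1 - η) := by
  have hk0 : (0 : ℝ) < k := by exact_mod_cast (show 0 < k by omega)
  set d := g.natDegree with hd
  -- `s = ⌊d/k⌋ + 1`, `q = s (s + 1)`, the exponent `e = d/k - s < 0`
  set s : ℕ := d / k + 1 with hs
  have hs1 : 1 ≤ s := Nat.le_add_left 1 (d / k)
  have hks : d < k * s := by rw [hs]; exact Nat.lt_mul_div_succ d (by omega)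
  set q : ℕ := s * (s + 1) with hq
  have hq0 : q ≠ 0 := by rw [hq]; positivity
  have hq0R : (0 : ℝ) < q := by exact_mod_cast Nat.pos_of_ne_zero hq0
  have hs0R : (0 : ℝ) < s := by exact_mod_cast hs1
  set e : ℝ := (d : ℝ) / k - s with he
  have he0 : e < 0 := by
    rw [he, sub_neg, div_lt_iff₀ hk0]
    exact_mod_cast (show d < s * k by rw [mul_comm]; exact hks)
  set ε₁ : ℝ := e / 2 * ((q : ℕ) : ℝ)⁻¹ with hε₁
  have hε₁0 : ε₁ < 0 := by
    rw [hε₁]; exact mul_neg_of_neg_of_pos (by linarith) (by positivity)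
  set η : ℝ := -ε₁ with hη
  have hη0 : 0 < η := by rw [hη]; linarith
  -- the exported exponent `η₀ = min η (1/2)`
  set η₀ : ℝ := min η (1 / 2) with hη₀
  have hη₀0 : 0 < η₀ := lt_min hη0 (by norm_num)
  have hη₀η : η₀ ≤ η := min_le_left _ _
  have hη₀2 : η₀ ≤ 1 / 2 := min_le_right _ _
  obtain ⟨T₁, M, hT₁, hM, hsp⟩ := exists_spacing_powValues_all (separable_map_real_of_irreducible hirr hdeg)
    hdeg hlc hk s hs1 hks.le
  -- the constant `K = M^{1/q}` of the main term `s K x^{1-η}`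
  set K : ℝ := M ^ ((q : ℕ) : ℝ)⁻¹ with hK
  have hK0 : 0 < K := by rw [hK]; exact Real.rpow_pos_of_pos hM _
  set n₁ : ℕ := ⌈T₁⌉₊ with hn₁
  refine ⟨η₀, (n₁ : ℝ) + 1 + s + 1 + s * K, hη₀0, ?_⟩
  filter_upwards [eventually_ge_atTop (max n₁ 3)] with x hx
  have hxn₁ : n₁ ≤ x := (le_max_left _ _).trans hx
  have hx3' : 3 ≤ x := (le_max_right _ _).trans hx
  have hxpos : (0 : ℝ) < x := by exact_mod_cast (show 0 < x by omega)
  have hx1 : (1 : ℝ) ≤ x := by exact_mod_cast (show 1 ≤ x by omega)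
  -- the threshold `N₀ = max n₁ (⌊√x⌋ + 1)`
  set N₀ : ℕ := max n₁ (⌊Real.sqrt x⌋₊ + 1) with hN₀
  have hN₀n₁ : n₁ ≤ N₀ := le_max_left _ _
  have hT₁N₀ : T₁ ≤ (N₀ : ℝ) := (Nat.le_ceil T₁).trans (by exact_mod_cast hN₀n₁)
  have hsqrt_le : Real.sqrt x ≤ N₀ := by
    have h1 : Real.sqrt x < (⌊Real.sqrt x⌋₊ : ℝ) + 1 := Nat.lt_floor_add_one _
    have h2 : ((⌊Real.sqrt x⌋₊ + 1 : ℕ) : ℝ) ≤ N₀ := by exact_mod_cast le_max_right _ _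
    push_cast at h2
    linarith
  have hN₀le : (N₀ : ℝ) ≤ n₁ + Real.sqrt x + 1 := by
    have h1 : N₀ ≤ n₁ + (⌊Real.sqrt x⌋₊ + 1) := max_le (Nat.le_add_right _ _) (Nat.le_add_left _ _)
    have h2 : (N₀ : ℝ) ≤ n₁ + (⌊Real.sqrt x⌋₊ + 1) := by exact_mod_cast h1
    have h3 : (⌊Real.sqrt x⌋₊ : ℝ) ≤ Real.sqrt x := Nat.floor_le (Real.sqrt_nonneg _)
    linarith
  have hN₀x : N₀ ≤ x := by
    refine max_le hxn₁ ?_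
    have hx3r : (3 : ℝ) ≤ x := by exact_mod_cast hx3'
    have hsx : Real.sqrt x + 1 ≤ x := by
      have hs1 : Real.sqrt x ≤ (x : ℝ) / 2 + 1 / 2 := by
        rw [Real.sqrt_le_left (by positivity)]
        nlinarith
      nlinarith [Real.sq_sqrt hxpos.le, Real.sqrt_nonneg (x : ℝ)]
    have h1 : ((⌊Real.sqrt x⌋₊ + 1 : ℕ) : ℝ) ≤ x := by
      push_cast
      linarith [Nat.floor_le (Real.sqrt_nonneg (x : ℝ))]
    exact_mod_cast h1
  have hN₀pos : (0 : ℝ) < N₀ := by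
    have := Real.sqrt_pos.mpr hxpos
    linarith
  -- the spacing `L = (c⁻¹)^{1/q}`, `c = M N₀^e`, on `[N₀, x]`
  set c : ℝ := M * (N₀ : ℝ) ^ e with hc
  have hc0 : 0 < c := by rw [hc]; exact mul_pos hM (Real.rpow_pos_of_pos hN₀pos e)
  set L : ℝ := c⁻¹ ^ ((q : ℕ) : ℝ)⁻¹ with hL
  have hL0 : 0 < L := by rw [hL]; exact Real.rpow_pos_of_pos (inv_pos.mpr hc0) _
  set T := (Icc N₀ x).filter (fun n : ℕ => ∃ m : ℕ, (g.eval (n : ℤ)).natAbs = m ^ k) with hT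
  have hTsub : T ⊆ Icc N₀ x := filter_subset _ _
  have hsep : ∀ a ∈ T, ∀ b ∈ T, a ≤ b → s + 1 ≤ #(T.filter fun n => a ≤ n ∧ n ≤ b) →
      L ≤ (b : ℝ) - a := by
    intro a ha b hb hab hcard
    obtain ⟨n, hn, hnS⟩ := exists_strictMono_mem_of_le_card hcard
    have hnT : ∀ i, n i ∈ T := fun i => (mem_filter.mp (hnS i)).1
    have hN₀n : (N₀ : ℝ) ≤ n 0 := by exact_mod_cast (mem_Icc.mp (hTsub (hnT 0))).1
    have hsol : ∀ i, ∃ m : ℕ, (g.eval (n i : ℤ)).natAbs = m ^ k := fun i => (mem_filter.mp (hnT i)).2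
    have h1 := hsp N₀ hT₁N₀ n hn hN₀n hsol
    rw [← hd, ← he, ← hc, ← hq] at h1
    have han : (a : ℝ) ≤ n 0 := by exact_mod_cast (mem_filter.mp (hnS 0)).2.1
    have hnb : (n (Fin.last s) : ℝ) ≤ b := by exact_mod_cast (mem_filter.mp (hnS (Fin.last s))).2.2
    have hW : 0 ≤ (n (Fin.last s) : ℝ) - n 0 := by
      have := hn.monotone (Fin.zero_le (Fin.last s))
      exact sub_nonneg.mpr (by exact_mod_cast this)
    have h2 := inv_rpow_inv_le_of_one_le_mul hq0 hc0 hW h1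
    rw [← hL] at h2
    linarith
  have hcardT := card_le_mul_of_block_spacing hTsub hN₀x hL0 s hsep
  -- `1/L ≤ K x^{ε₁}`: from `N₀ ≥ √x` and `e < 0`
  have hinvL : 1 / L ≤ K * (x : ℝ) ^ ε₁ := by
    have hsx : 0 < Real.sqrt x := Real.sqrt_pos.mpr hxpos
    have h1 : (N₀ : ℝ) ^ e ≤ (Real.sqrt x) ^ e := Real.rpow_le_rpow_of_nonpos hsx hsqrt_le he0.le
    have h2 : (Real.sqrt x) ^ e = (x : ℝ) ^ (e / 2) := by
      rw [Real.sqrt_eq_rpow, ← Real.rpow_mul hxpos.le]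
      congr 1
      ring
    have hcle : c ≤ M * (x : ℝ) ^ (e / 2) := by
      rw [hc, ← h2]
      exact mul_le_mul_of_nonneg_left h1 hM.le
    have hinv : 1 / L = c ^ ((q : ℕ) : ℝ)⁻¹ := by
      rw [hL, one_div, ← Real.inv_rpow (inv_nonneg.mpr hc0.le), inv_inv]
    rw [hinv, hK]
    calc c ^ ((q : ℕ) : ℝ)⁻¹ ≤ (M * (x : ℝ) ^ (e / 2)) ^ ((q : ℕ) : ℝ)⁻¹ :=
          Real.rpow_le_rpow hc0.le hcle (by positivity)
      _ = M ^ ((q : ℕ) : ℝ)⁻¹ * ((x : ℝ) ^ (e / 2)) ^ ((q : ℕ) : ℝ)⁻¹ :=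
          Real.mul_rpow hM.le (by positivity)
      _ = M ^ ((q : ℕ) : ℝ)⁻¹ * (x : ℝ) ^ ε₁ := by
          rw [← Real.rpow_mul hxpos.le]
  -- the main term `(x - N₀)/L ≤ K x^{1 + ε₁} = K x^{1 - η} ≤ K x^{1 - η₀}`
  have hmain : ((x : ℝ) - N₀) / L ≤ K * (x : ℝ) ^ (1 - η₀) := by
    have h1 : ((x : ℝ) - N₀) / L ≤ (x : ℝ) * (1 / L) := by
      rw [mul_one_div]
      exact div_le_div_of_nonneg_right (by linarith) hL0.le
    have h2 : (x : ℝ) * (1 / L) ≤ x * (K * (x : ℝ) ^ ε₁) := mul_le_mul_of_nonneg_left hinvL hxpos.le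
    have h3 : (x : ℝ) * (K * (x : ℝ) ^ ε₁) = K * (x : ℝ) ^ (1 - η) := by
      rw [hη, sub_neg_eq_add, Real.rpow_add hxpos, Real.rpow_one]
      ring
    have h4 : (x : ℝ) ^ (1 - η) ≤ (x : ℝ) ^ (1 - η₀) :=
      Real.rpow_le_rpow_of_exponent_le hx1 (by linarith)
    calc ((x : ℝ) - N₀) / L ≤ K * (x : ℝ) ^ (1 - η) := by rw [← h3]; exact h1.trans h2
      _ ≤ K * (x : ℝ) ^ (1 - η₀) := mul_le_mul_of_nonneg_left h4 hK0.le
  -- assemble: `#S ≤ N₀ + #T ≤ (n₁ + √x + 1) + s ((x - N₀)/L + 1)`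
  have hsplit : (#((Icc 1 x).filter fun n : ℕ => ∃ m : ℕ, (g.eval (n : ℤ)).natAbs = m ^ k) : ℝ)
      ≤ N₀ + #T := by
    have hsub : (Icc 1 x).filter (fun n : ℕ => ∃ m : ℕ, (g.eval (n : ℤ)).natAbs = m ^ k)
        ⊆ range N₀ ∪ T := by
      intro n hn
      obtain ⟨hnI, hmn⟩ := mem_filter.mp hn
      rw [mem_union]
      by_cases hnN : n < N₀
      · exact Or.inl (mem_range.mpr hnN)
      · exact Or.inr (mem_filter.mpr ⟨mem_Icc.mpr ⟨not_lt.mp hnN, (mem_Icc.mp hnI).2⟩, hmn⟩)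
    have h := (card_le_card hsub).trans (card_union_le _ _)
    rw [card_range] at h
    exact_mod_cast h
  have hx1η : (1 : ℝ) ≤ (x : ℝ) ^ (1 - η₀) := Real.one_le_rpow hx1 (by linarith)
  have hA : (n₁ : ℝ) + 1 + s ≤ ((n₁ : ℝ) + 1 + s) * (x : ℝ) ^ (1 - η₀) :=
    le_mul_of_one_le_right (by positivity) hx1η
  have hB : Real.sqrt x ≤ (x : ℝ) ^ (1 - η₀) := by
    rw [Real.sqrt_eq_rpow]
    exact Real.rpow_le_rpow_of_exponent_le hx1 (by linarith)
  have hC : (s : ℝ) * (((x : ℝ) - N₀) / L + 1) - s ≤ s * K * (x : ℝ) ^ (1 - η₀) :=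
    calc (s : ℝ) * (((x : ℝ) - N₀) / L + 1) - s = s * (((x : ℝ) - N₀) / L) := by ring
      _ ≤ s * (K * (x : ℝ) ^ (1 - η₀)) := mul_le_mul_of_nonneg_left hmain hs0R.le
      _ = s * K * (x : ℝ) ^ (1 - η₀) := by ring
  calc (#((Icc 1 x).filter fun n : ℕ => ∃ m : ℕ, (g.eval (n : ℤ)).natAbs = m ^ k) : ℝ)
      ≤ (N₀ : ℝ) + #T := hsplit
    _ ≤ (n₁ + Real.sqrt x + 1) + s * (((x : ℝ) - N₀) / L + 1) := add_le_add hN₀le hcardT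
    _ = ((n₁ : ℝ) + 1 + s) + Real.sqrt x + (s * (((x : ℝ) - N₀) / L + 1) - s) := by ring
    _ ≤ ((n₁ : ℝ) + 1 + s) * (x : ℝ) ^ (1 - η₀) + (x : ℝ) ^ (1 - η₀)
          + s * K * (x : ℝ) ^ (1 - η₀) := add_le_add_three hA hB hC
    _ = ((n₁ : ℝ) + 1 + s + 1 + s * K) * (x : ℝ) ^ (1 - η₀) := by ring

open scoped Classical in
/-- **Every power of `log`:** `#{n ≤ x : |g(n)| = m^k for some m} · log^j x ≤ δ x` eventually, for all `j`
and `δ > 0` (`g` irreducible, `deg g ≥ 1`, positive leading coefficient, `k ≥ 2`). -/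
theorem eventually_card_powValues_mul_log_pow_le {g : ℤ[X]} (hirr : Irreducible g)
    (hdeg : 1 ≤ g.natDegree) (hlc : 0 < g.leadingCoeff) {k : ℕ} (hk : 2 ≤ k) (j : ℕ) {δ : ℝ}
    (hδ : 0 < δ) :
    ∀ᶠ x : ℕ in atTop,
      (#((Icc 1 x).filter fun n : ℕ => ∃ m : ℕ, (g.eval (n : ℤ)).natAbs = m ^ k) : ℝ)
        * Real.log x ^ j ≤ δ * x := by
  obtain ⟨η, C, hη, h⟩ := exists_eventually_card_powValues_le_rpow hirr hdeg hlc hk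
  exact eventually_mul_log_pow_le_of_le_rpow hη h j hδ

end Summit.Parity.BatemanHorn.Theorems
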